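import Summits.BirchSwinnertonDyer.BirchSwinnertonDyer.Theorems.GenusKolyvaginAtTwoShaCardDvdPowAtTwoRTwoPowerImageOverKGroup
import Summits.BirchSwinnertonDyer.BirchSwinnertonDyer.Theorems.GenusKolyvaginAtTwoShaCardDvdPowAtTwoRTwoPowerImageOverKWitness
import Summits.BirchSwinnertonDyer.BirchSwinnertonDyer.Theorems.GenusKolyvaginAtTwoShaCardDvdPowAtTwoRTwoPowerImageOverKLink
import Literature.NumberTheory.GaloisRepresentations.TateLevelOneWildOdd
import Literature.NumberTheory.DiophantineGeometry.GenEllLAdicImageSurjective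
import Literature.NumberTheory.Automorphic.QuadraticCharacterTwist
import Literature.NumberTheory.QuadraticFields.ThreeTorsion
import Literature.NumberTheory.EllipticCurves.HeegnerPointsImaginaryQuadraticProofs
import HarnessLib

/-!
# The `ℚ → K` transfer of `2`-power surjectivity, II: `Gal(K̄/K) → Aut(E_K[2ⁿ])` is onto for every `n`,
# for `E/ℚ` with `ρ̄_{E,8}` onto and a quadratic field `K` with `2 ∤ d_K`, `√±Δ, √±2Δ ∉ K` — in particular
# on the habitat of route `GenusKolyvaginAtTwo` (`K` imaginary quadratic, `d_K` odd, `d_K·(−|Δ|)`,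
# `d_K·(−2|Δ|) ∉ ℚ²`, `ρ_{E,2^∞}` onto): `K ∩ ℚ(E[2ⁿ]) = ℚ`, `Gal(K(E[2ⁿ])/K) ≅ GL₂(ℤ/2ⁿ)`

Route `GenusKolyvaginAtTwo` (BirchSwinnertonDyer), seat `bsd-line-gk2-p3` g15 (cell `bsd-f1-sign2`),
`--supports stmt-BirchSwinnertonDyer-28029` (helper; closes nothing). THEOREMS ONLY (no definition, no named
fact, no `sorry`). BSD is not proved by any of this.

WHY. Every Kolyvagin argument at `p = 2` that runs OVER `K` — the Čebotarev step in `K(E[2^M])/K`, the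
Lawson–Wuthrich bound `#H¹(K(E[2^M])/K, E[2^M]) ≤ 2` (LEAD gk2-p1 g11,
`LawsonWuthrich2016.natCard_subgroupResKer_two_pow_le_two`, hypothesis `HasSurjectiveModNGaloisRep (2^k)` OVER
THE BASE FIELD of the `H¹`), the disjointness input `hNfix` of this lineage's (H2′)
(`…ShaCardDvdPowAtTwoREntanglement.sel_visible_two_of_kernel_inputs`) — needs the `2^k`-image of `Γ_K`, while
the crux binders of 22137 / Q3R 27720 / U 28029 / L 28030 give the image of `Γ_ℚ` (`∀ n > 0,
W.HasSurjectiveModNGaloisRep (2^n)`) plus the side conditions `Odd d_K`, `d_K·(−|Δ|) ∉ ℚ²`,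
`d_K·(−2|Δ|) ∉ ℚ²`. This file proves that those side conditions are EXACTLY what makes the transfer work
(LEAD memo `Cruxes/GenusPrimitiveSupplyAtTwo/Lines/genus-supply-g11.md` §2: «that transfer is NOT in these
files»). At odd `p` the transfer is the tree's `AdicImageOverK` / `ThreeAdicImageOverK` files (index `2` is
prime to `p`); at `p = 2` the index-`2` subgroup `Gal(ℚ̄/K)` can a priori lose any of the seven quadratic
subfields `ℚ(√d)`, `d ∈ ⟨−1, 2, Δ⟩`, of `ℚ(E[8])`.

* (sibling `…TwoPowerImageOverKLink`: transport of surjectivity along `E(ℚ̄) ≃ E_K(K̄)`; the `E[2]`-link;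
  `Δ, −Δ, 2Δ, −2Δ ∉ ℚ²` from `ρ̄_{E,8}` onto. Sibling `…TwoPowerImageOverKWitness`: the transposition fixing
  `ζ₈` in `Gal(ℚ̄/K)`. Sibling `…TwoPowerImageOverKGroup`: the subgroup criterion in `GL₂(ℤ/8)`.)
* §3 **`hasSurjectiveModNGaloisRep_eight_baseChange`** — level `8` over `K` (group theory
  `eq_top_of_sq_mem_of_det_of_transposition` + witness `exists_sign_permGal_eq_neg_one_and_cyclotomic_eq_one` +
  `det ρ̄ = χ₈` + `χ₈(Γ_K) = (ℤ/8)ˣ` for `2 ∤ d_K`);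
* §4 **`hasSurjectiveModNGaloisRep_two_pow_baseChange`** — every level `2ⁿ` over `K` (mod-`8` lifting,
  Rouse–Zureick-Brown / Vasiu, tree `surjective_of_surjective_castHom_eight_comp`, run over `K`);
* §5 **`hasSurjectiveModNGaloisRep_two_pow_baseChange_of_habitat`** — the binders of the GK2 cruxes verbatim
  (`IsImaginaryQuadratic K`, `Odd d_K`, `¬ IsSquare (d_K · −|Δ|)`, `¬ IsSquare (d_K · −(2|Δ|))`,
  `∀ n > 0, W.HasSurjectiveModNGaloisRep (2^n)`) ⟹ `∀ n, (W.baseChange K).HasSurjectiveModNGaloisRep (2^n)`.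

References: [Serre1972] §5.3; [RouseZureickbrown2015] §1, §3 Lemma; [DokchitserDokchitserMathZ2012] Theorem;
[LawsonWuthrich2016] §7; [McCallumLMS1991] §3 (Čebotarev in `K(E[p^M])/K`).
-/

set_option autoImplicit false
set_option linter.dupNamespace false

noncomputable section

open scoped Classical

namespace Summit.BirchSwinnertonDyer.BirchSwinnertonDyer.Theorems.GenusExact.TwoPowerImageOverK

open WeierstrassCurve Field
open Literature.NumberTheory.EllipticCurves Literature.NumberTheory.GaloisRepresentations
open Literature.NumberTheory.EllipticCurves.DokchitserDokchitser2012
open scoped Matrix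

universe u

/-! ## §3 Level `8` over `K` -/

section LevelEight

variable (W : WeierstrassCurve ℚ) [W.IsElliptic] (K : Type) [Field K] [NumberField K]

/-- **`Gal(K̄/K) → Aut(E_K[8])` is onto** for `E/ℚ` with `ρ̄_{E,8}` onto and a quadratic field `K` with
`2 ∤ d_K` in which none of `Δ, −Δ, 2Δ, −2Δ` is a square. Proof: `M = ρ̄_{E,8}(Gal(ℚ̄/K)) ≤ GL₂(ℤ/8)`
contains every square (index `2`), attains every determinant (`det ρ̄ = χ₈`, `χ₈(Γ_K)` onto as
`K ∩ ℚ(ζ₈) = ℚ`), and contains the transposition fixing `ζ₈` of the sibling file; so `M = GL₂(ℤ/8)`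
(`eq_top_of_sq_mem_of_det_of_transposition`), and surjectivity transports to `E_K`.
[cite: Serre1972, §5.3] [cite: RouseZureickbrown2015, §3] -/
theorem hasSurjectiveModNGaloisRep_eight_baseChange (hK2 : Module.finrank ℚ K = 2)
    (hd : ¬ (2 : ℤ) ∣ NumberField.discr K)
    (hΔ : ¬ IsSquare (algebraMap ℚ K W.Δ)) (hnΔ : ¬ IsSquare (algebraMap ℚ K (-W.Δ)))
    (h2Δ : ¬ IsSquare (algebraMap ℚ K (2 * W.Δ))) (hn2Δ : ¬ IsSquare (algebraMap ℚ K (-2 * W.Δ)))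
    (hsurj : W.HasSurjectiveModNGaloisRep 8) :
    (W.baseChange K).HasSurjectiveModNGaloisRep 8 := by
  haveI : Fact (Nat.Prime 2) := ⟨Nat.prime_two⟩
  haveI : NeZero ((8 : ℕ) : ℚ) := ⟨by norm_num⟩
  haveI : NeZero ((8 : ℕ) : K) := ⟨by norm_num⟩
  have h2Q : ((2 : ℕ) : ℚ) ≠ 0 := by norm_num
  have h2Q' : (2 : ℚ) ≠ 0 := two_ne_zero
  have hsurj' : W.HasSurjectiveModNGaloisRep ((2 ^ 3 : ℕ) : ℤ) := by exact_mod_cast hsurj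
  obtain ⟨e⟩ := nonempty_addEquiv_geomTorsion W 2 3 (by norm_num) h2Q
  obtain ⟨ρ, hρ⟩ := exists_rep_of_addEquiv W e
  have hρs := rep_surjective_of_hasSurjectiveModNGaloisRep W e ρ hρ hsurj'
  obtain ⟨g₁, hg₁⟩ := exists_frame_torsion_of_frame_pow W 2 1 2 h2Q e ρ hρ
  set red : GL (Fin 2) (ZMod (2 ^ (1 + 2))) →* GL (Fin 2) (ZMod (2 ^ 1)) :=
    Matrix.GeneralLinearGroup.map (ZMod.castHom (pow_dvd_pow 2 (Nat.le_add_right 1 2)) (ZMod (2 ^ 1)))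
    with hred_def
  have hdetχ : ∀ σ : absoluteGaloisGroup ℚ,
      Matrix.GeneralLinearGroup.det (ρ σ) = modNCyclotomicCharacter ℚ 8 σ := fun σ ↦
    Units.ext (by
      rw [Matrix.GeneralLinearGroup.val_det_apply]
      exact det_eq_modNCyclotomicCharacter W (2 ^ 3) (by norm_num) e σ _ (hρ σ))
  -- the image `M` of `Gal(ℚ̄/K)`
  set H : Subgroup (absoluteGaloisGroup ℚ) := (absGaloisRestrict ℚ K).range with hH
  set M : Subgroup (GL (Fin 2) (ZMod 8)) := H.map ρ with hM
  -- (i) squares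
  obtain ⟨-, hind⟩ := Literature.NumberTheory.Automorphic.isOpen_range_absGaloisRestrict_and_index_eq_two ℚ K hK2
  have hsq : ∀ g : GL (Fin 2) (ZMod 8), g * g ∈ M := fun g ↦ by
    obtain ⟨γ, rfl⟩ := hρs g
    exact ⟨γ * γ, Subgroup.mul_self_mem_of_index_two hind γ, map_mul ρ γ γ⟩
  -- (ii) determinants
  have hcop : ∀ p : ℕ, p.Prime → p ∣ 8 → ¬ ((p : ℤ) ∣ NumberField.discr K) := by
    intro p hp hp8
    have hp2 : p = 2 :=
      (Nat.prime_dvd_prime_iff_eq hp Nat.prime_two).mp (hp.dvd_of_dvd_pow (show p ∣ 2 ^ 3 from hp8))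
    subst hp2
    exact_mod_cast hd
  have hdet : ∀ d : (ZMod 8)ˣ, ∃ m ∈ M, Matrix.GeneralLinearGroup.det m = d := fun d ↦ by
    obtain ⟨τ, hτ⟩ := modNCyclotomicCharacter_surjective_of_forall_prime_dvd_not_dvd_discr K 8 hcop d
    refine ⟨ρ (absGaloisRestrict ℚ K τ), ⟨_, ⟨τ, rfl⟩, rfl⟩, ?_⟩
    rw [hdetχ, modNCyclotomicCharacter_absGaloisRestrict ℚ K 8 τ, hτ]
  -- (iii) the transposition fixing `ζ₈`
  obtain ⟨τ₀, hsign, hχ1⟩ :=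
    exists_sign_permGal_eq_neg_one_and_cyclotomic_eq_one W K hd hΔ hnΔ h2Δ hn2Δ
  have hodd : ∃ m ∈ M, red m * red m = 1 ∧ red m ≠ 1 ∧ Matrix.GeneralLinearGroup.det m = 1 := by
    have hlink := (sign_permGal_eq_neg_one_iff W h2Q' (red.comp ρ) g₁ (fun τ v ↦ hg₁ τ v)
      (absGaloisRestrict ℚ K τ₀)).mp hsign
    rw [MonoidHom.comp_apply] at hlink
    exact ⟨ρ (absGaloisRestrict ℚ K τ₀), ⟨_, ⟨τ₀, rfl⟩, rfl⟩, hlink.1, hlink.2, by rw [hdetχ, hχ1]⟩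
  -- the group theory
  have hredq : ∀ (g : GL (Fin 2) (ZMod 8)) (i j : Fin 2), (red g : Matrix (Fin 2) (Fin 2) (ZMod 2)) i j =
      ZMod.castHom (show 2 ∣ 8 by norm_num) (ZMod 2) ((g : Matrix (Fin 2) (Fin 2) (ZMod 8)) i j) :=
    fun g i j ↦ rfl
  have htop : M = ⊤ := eq_top_of_sq_mem_of_det_of_transposition red hredq M hsq hdet hodd
  -- transport
  have h8 : (W.baseChange K).HasSurjectiveModNGaloisRep ((8 : ℕ) : ℤ) := by
    refine hasSurjectiveModNGaloisRep_baseChange_of_forall_exists' W K 8 (by exact_mod_cast hsurj)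
      fun γ ↦ ?_
    have hγ : ρ γ ∈ M := htop ▸ Subgroup.mem_top _
    obtain ⟨h, ⟨τ, rfl⟩, hhγ⟩ := hγ
    have hhγ' : ρ (absGaloisRestrict ℚ K τ) = ρ γ := hhγ
    refine ⟨τ, fun P hP ↦ ?_⟩
    have key : absGaloisRestrict ℚ K τ • (⟨P, hP⟩ : geomTorsion W ((2 ^ 3 : ℕ) : ℤ)) = γ • ⟨P, hP⟩ :=
      e.injective (by rw [hρ, hρ, hhγ'])
    exact congrArg Subtype.val key
  exact_mod_cast h8

end LevelEight

/-! ## §4 Every level `2ⁿ` over `K` -/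

section AllLevels

variable (W : WeierstrassCurve ℚ) [W.IsElliptic] (K : Type) [Field K] [NumberField K]

/-- **`Gal(K̄/K) → Aut(E_K[2ⁿ])` is onto for every `n`** — for `E/ℚ` with `ρ̄_{E,8}` onto and a quadratic
field `K` with `2 ∤ d_K` in which none of `Δ, −Δ, 2Δ, −2Δ` is a square (equivalently `K ∩ ℚ(E[2ⁿ]) = ℚ`,
`Gal(K(E[2ⁿ])/K) ≅ GL₂(ℤ/2ⁿ)`): level `8` by `hasSurjectiveModNGaloisRep_eight_baseChange`, levels `≤ 4`
downward, levels `≥ 8` by the mod-`8` lifting theorem (Rouse–Zureick-Brown 2015 §3 / Vasiu 2003 4.1.2,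
tree `surjective_of_surjective_castHom_eight_comp`) run over `K` — verbatim the tree's discharge
`hasSurjectiveModNGaloisRep_two_pow_of_eight_holds` with base field `K`.
[cite: RouseZureickbrown2015, §1 and §3 Lemma] [cite: DokchitserDokchitserMathZ2012, Introduction] -/
theorem hasSurjectiveModNGaloisRep_two_pow_baseChange (hK2 : Module.finrank ℚ K = 2)
    (hd : ¬ (2 : ℤ) ∣ NumberField.discr K)
    (hΔ : ¬ IsSquare (algebraMap ℚ K W.Δ)) (hnΔ : ¬ IsSquare (algebraMap ℚ K (-W.Δ)))
    (h2Δ : ¬ IsSquare (algebraMap ℚ K (2 * W.Δ))) (hn2Δ : ¬ IsSquare (algebraMap ℚ K (-2 * W.Δ)))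
    (hsurj : W.HasSurjectiveModNGaloisRep 8) (n : ℕ) :
    (W.baseChange K).HasSurjectiveModNGaloisRep ((2 : ℤ) ^ n) := by
  haveI : Fact (Nat.Prime 2) := ⟨Nat.prime_two⟩
  haveI : (W.baseChange K).IsElliptic := by rw [baseChange]; infer_instance
  have h2K : ((2 : ℕ) : K) ≠ 0 := by norm_num
  have hcast : ((2 ^ n : ℕ) : ℤ) = (2 : ℤ) ^ n := by push_cast; rfl
  rw [← hcast]
  have h8 : (W.baseChange K).HasSurjectiveModNGaloisRep ((2 ^ 3 : ℕ) : ℤ) := by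
    exact_mod_cast hasSurjectiveModNGaloisRep_eight_baseChange W K hK2 hd hΔ hnΔ h2Δ hn2Δ hsurj
  rcases Nat.lt_or_ge n 3 with hn | hn
  · interval_cases n
    · -- `n = 0`: `E[1] = 0`
      haveI : Subsingleton (geomTorsion (W.baseChange K) ((2 ^ 0 : ℕ) : ℤ)) := ⟨fun a b ↦ by
        have ha := AddSubgroup.torsionBy.nsmul_iff.mp a.2
        have hb := AddSubgroup.torsionBy.nsmul_iff.mp b.2
        simp only [pow_zero, one_smul] at ha hb
        exact Subtype.ext (ha.trans hb.symm)⟩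
      intro y
      exact ⟨1, Multiplicative.toAdd.injective (AddEquiv.ext fun a ↦ Subsingleton.elim _ _)⟩
    · exact hasSurjectiveModNGaloisRep_pow_of_pow_add (W.baseChange K) 2 1 2 one_pos h2K h8
    · exact hasSurjectiveModNGaloisRep_pow_of_pow_add (W.baseChange K) 2 2 1 two_pos h2K h8
  · obtain ⟨j, rfl⟩ : ∃ j, n = 3 + j := ⟨n - 3, by omega⟩
    obtain ⟨e⟩ := nonempty_addEquiv_geomTorsion (W.baseChange K) 2 (3 + j) (by omega) h2K
    obtain ⟨ρ, hρ⟩ := exists_rep_of_addEquiv (W.baseChange K) e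
    have hρsurj : Function.Surjective ρ := by
      refine surjective_of_surjective_castHom_eight_comp hn ρ (fun t ↦ ?_)
      obtain ⟨σ, hσ⟩ :=
        exists_map_eq_of_hasSurjectiveModNGaloisRep_pow (W.baseChange K) 2 3 j h2K e ρ hρ h8 t
      exact ⟨σ, hσ⟩
    exact hasSurjectiveModNGaloisRep_of_rep_surjective (W.baseChange K) e ρ hρ hρsurj

end AllLevels

/-! ## §5 On the habitat of route `GenusKolyvaginAtTwo` -/

section Habitat

open Literature.NumberTheory.QuadraticFields

variable (W : WeierstrassCurve ℚ) [W.IsElliptic] (K : Type) [Field K] [NumberField K]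

/-- Rational squares in a quadratic field: if `[K : ℚ] = 2` and `r ∈ ℚ` is a square in `K`, then
`r ∈ ℚ²` or `d_K · r ∈ ℚ²` (`K = ℚ(γ)`, `γ² = d_K`; `(p + qγ)² = r` forces `pq = 0`). Same proof as the tree's
`KolyvaginImageTwo.isSquare_or_isSquare_mul_of_isSquare_algebraMap` (re-proved to avoid its import cone).
[folklore] -/
private theorem isSquare_or_isSquare_mul_of_isSquare_algebraMap' (hK2 : Module.finrank ℚ K = 2) {r : ℚ}
    (hr : IsSquare (algebraMap ℚ K r)) : IsSquare r ∨ IsSquare ((NumberField.discr K : ℚ) * r) := by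
  obtain ⟨γ, hγ, hγd⟩ := Quadratic.exists_not_mem_range_sq_eq_discr (K := K) hK2
  obtain ⟨c, hc⟩ := hr
  obtain ⟨p, q, hcpq⟩ := Quadratic.exists_eq_add_mul hK2 hγ c
  have hmul := Quadratic.add_mul_mul_add_mul hγd p q p q
  rw [← hcpq, ← hc] at hmul
  have hr' : algebraMap ℚ K r = algebraMap ℚ K r + algebraMap ℚ K 0 * γ := by
    rw [map_zero, zero_mul, add_zero]
  rw [hr'] at hmul
  obtain ⟨h1, h2⟩ := Quadratic.ext_add_mul hγ hmul
  have hpq : p * q = 0 := by linear_combination h2.symm / 2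
  rcases mul_eq_zero.mp hpq with hp | hq
  · right
    refine ⟨(NumberField.discr K : ℚ) * q, ?_⟩
    rw [h1, hp]; ring
  · left
    exact ⟨p, by rw [h1, hq]; ring⟩

/-- **On the habitat of the GK2 cruxes, `ρ_{E,2^∞}` is onto OVER `K`**: for `E/ℚ` (any model `W`) with
`ρ̄_{E,2ⁿ}` onto for all `n > 0`, and `K` imaginary quadratic with `d_K` odd, `d_K·(−|Δ|) ∉ ℚ²`,
`d_K·(−2|Δ|) ∉ ℚ²` — the binders of 22137 / Q3R 27720 / U 28029 / L 28030 / 24947 verbatim — the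
representation `Gal(K̄/K) → Aut(E_K[2ⁿ])` is onto for every `n`; i.e. `K ∩ ℚ(E[2ⁿ]) = ℚ` and
`Gal(K(E[2ⁿ])/K) ≅ GL₂(ℤ/2ⁿ)`. (The side conditions are exactly the exclusion of the seven quadratic
subfields `ℚ(√d)`, `d ∈ ⟨−1, 2, Δ⟩`, of `ℚ(E[8])`: `d_K` odd excludes `−1, ±2`; `K` imaginary and the two
non-square binders exclude `±Δ, ±2Δ`; `Δ, −Δ, ±2Δ ∉ ℚ²` themselves follow from `ρ̄_{E,8}` onto.) This is the
input «`HasSurjectiveModNGaloisRep (2^k)` over the base field» of the Lawson–Wuthrich bound at `2` over `K`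
and of the Čebotarev steps in `K(E[2^M])/K`. [cite: Serre1972, §5.3] [cite: RouseZureickbrown2015, §3]
[cite: McCallumLMS1991, §3 (Čebotarev in K(E[p^M])/K)] -/
theorem hasSurjectiveModNGaloisRep_two_pow_baseChange_of_habitat (hK : IsImaginaryQuadratic K)
    (hodd : Odd (NumberField.discr K)) (hsq1 : ¬ IsSquare ((NumberField.discr K : ℚ) * -|W.Δ|))
    (hsq2 : ¬ IsSquare ((NumberField.discr K : ℚ) * (-(2 * |W.Δ|))))
    (hρ : ∀ n : ℕ, 0 < n → W.HasSurjectiveModNGaloisRep ((2 : ℤ) ^ n)) (n : ℕ) :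
    (W.baseChange K).HasSurjectiveModNGaloisRep ((2 : ℤ) ^ n) := by
  have hK2 : Module.finrank ℚ K = 2 := hK.1
  have hd : ¬ (2 : ℤ) ∣ NumberField.discr K := fun h ↦
    (Int.not_even_iff_odd.mpr hodd) (even_iff_two_dvd.mpr h)
  have h8 : W.HasSurjectiveModNGaloisRep 8 := by
    have := hρ 3 (by norm_num)
    norm_num at this
    exact this
  obtain ⟨hQ1, hQ2, hQ3, hQ4⟩ := not_isSquare_four_of_hasSurjectiveModNGaloisRep_eight W h8
  have hdneg : (NumberField.discr K : ℚ) < 0 := by exact_mod_cast hK.discr_neg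
  have hΔ0 : W.Δ ≠ 0 := by rw [← WeierstrassCurve.coe_Δ']; exact W.Δ'.ne_zero
  have hneg : ∀ q : ℚ, q < 0 → ¬ IsSquare q := fun q hq ⟨r, hr⟩ ↦ by nlinarith [mul_self_nonneg r]
  have key : ∀ m : ℚ, ¬ IsSquare m → ¬ IsSquare ((NumberField.discr K : ℚ) * m) →
      ¬ IsSquare (algebraMap ℚ K m) := fun m h1 h2 h ↦
    (isSquare_or_isSquare_mul_of_isSquare_algebraMap' K hK2 h).elim h1 h2
  rcases lt_or_gt_of_ne hΔ0 with hlt | hgt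
  · -- `Δ < 0`: `−|Δ| = Δ`, `−2|Δ| = 2Δ`
    have e1 : -|W.Δ| = W.Δ := by rw [abs_of_neg hlt, neg_neg]
    have e2 : -(2 * |W.Δ|) = 2 * W.Δ := by rw [abs_of_neg hlt]; ring
    rw [e1] at hsq1
    rw [e2] at hsq2
    exact hasSurjectiveModNGaloisRep_two_pow_baseChange W K hK2 hd (key _ hQ1 hsq1)
      (key _ hQ2 (hneg _ (mul_neg_of_neg_of_pos hdneg (by linarith))))
      (key _ hQ3 hsq2) (key _ hQ4 (hneg _ (mul_neg_of_neg_of_pos hdneg (by linarith)))) h8 n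
  · -- `Δ > 0`: `−|Δ| = −Δ`, `−2|Δ| = −2Δ`
    have e1 : -|W.Δ| = -W.Δ := by rw [abs_of_pos hgt]
    have e2 : -(2 * |W.Δ|) = -2 * W.Δ := by rw [abs_of_pos hgt]; ring
    rw [e1] at hsq1
    rw [e2] at hsq2
    exact hasSurjectiveModNGaloisRep_two_pow_baseChange W K hK2 hd
      (key _ hQ1 (hneg _ (mul_neg_of_neg_of_pos hdneg hgt))) (key _ hQ2 hsq1)
      (key _ hQ3 (hneg _ (mul_neg_of_neg_of_pos hdneg (by linarith)))) (key _ hQ4 hsq2) h8 n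

end Habitat

end Summit.BirchSwinnertonDyer.BirchSwinnertonDyer.Theorems.GenusExact.TwoPowerImageOverK

end
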